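import Mathlib
import HarnessLib
import Summits.HubbardSuperconductivity.HubbardSuperconductivity.Theorems.KLProgrammeFermiSurfaceDopingWindow
import Summits.HubbardSuperconductivity.HubbardSuperconductivity.Theorems.KLProgrammeFermiSurfaceDopingWindowSharp
import Summits.HubbardSuperconductivity.HubbardSuperconductivity.Theorems.KLProgrammeMuOfDopingWindow
import Summits.HubbardSuperconductivity.HubbardSuperconductivity.Theorems.WeakCouplingBCSKlCertB1gDopingWindowD010D020

/-!
# Route `KLProgramme` (cruxes K3 `KLRegimeTwoPointLimit` / K1 `H10TwoPointLimit`) — risk-register item r2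
# «Fermi-surface hypotheses at `δ ∈ [0.10, 0.20]`» AS `δ`-THEOREMS

Cell `gate-hubbard-kl`, seat fs-1 (g6). Every Fermi-surface row of the fs-1 lineage is a `μ`-theorem (FS-WINDOW.md §1–§8:
`Theorems/KLProgrammeFermiSurface*.lean`). The route's statements speak of the DOPING `δ`, through the free-band chemical
potential `μ(δ) = chemicalPotentialOfDensity ε₀ (1 - δ)` (`ε₀ = squareDispersion 1 0`; cf. the crux decls `H10TwoPointLimit`,
`KLRegimeTwoPointLimit`). Two kernel-checked links `δ ↦ μ(δ)` exist in the tree: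

* S0 `muOfDopingWindow_proof` (eng, item stmt-…-19939): `δ ∈ [0.10, 0.35] ⇒ μ(δ) ∈ [-1, -0.15]` (the leaf's window);
* margin-2's `muOfDoping_mem_window_d010_d020` (p457690, polygon filling certificates by `decide +kernel`):
  `δ ∈ [0.10, 0.20] ⇒ μ(δ) ∈ [-0.42749, -0.1775]` (the window of record of the certificate half and of the risk register).

This file composes them with the lineage's rows (one owner each: the links are eng's / margin-2's, the rows fs-1's):

* §1 **on the window of record `δ ∈ [0.10, 0.20]`**, at `μ = μ(δ)`: `μ(δ) ∈ [-0.4275, -0.1775]`; `v_F = ‖∇ε‖ ≥ 0.8237`, `∇ε ≠ 0`,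
  `0.0313 ≤ κ ≤ 2.43`, nesting defect `≥ 0.355`; FST II (A1)–(A4), (Sy), (A3) global HOLD and (A5) FAILS, with the `(1,0)`
  umklapp quadruple and the `(1,0)`-corner (transversality factor `≥ 0.1018`) — «A5 fails on the window ⇒ C4b is
  load-bearing» as a `δ`-theorem; `GeomConstants e 4.4275 0.0887 0.575 0.0443`; FST III `Admits` + (H1)–(H4), `¬(H5)`;
  FST IV's inversion class, BGM 2006's regime/clause (3) and FKT 2004's hypotheses EXCLUDE the band, Salmhofer 1998's admit
  it; BGM 2003 `DispersionHyp`/`LatticeModelHyp`/Lemma 3.1 with `e₀ = 0.08`; `∂ₜF ≥ 0.8236`; ONE two-loop constant `Q`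
  (FST II Thm 1.1) for the whole doping window; the SHARP `BandBounds (-0.4275) (-0.1775)` bundle (`C_g ≤ 98`, …) covers
  every `μ(δ)`.
* §2 **on the leaf's window `δ ∈ [0.10, 0.35]`**, at `μ = μ(δ)`: the analysis-window rows — `v_F ≥ 0.7599`, `κ ≥ 0.026`,
  `∂ₜF ≥ 0.7599`, the qualitative hypothesis sets, BGM 2003 with `e₀ = 0.07`, corner transversality `≥ 0.083`, ONE `Q`,
  the SHARP `BandBounds (-1) (-0.15)` bundle (`C_g ≤ 162`).

No definitions; everything PROVED (compositions). [folklore]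
-/

noncomputable section

open Real Set

-- the tree's namespace `Summit.<Summit>.<Problem>.Theorems` repeats the summit name by design (D-0017)
set_option linter.dupNamespace false

namespace Summit.HubbardSuperconductivity.HubbardSuperconductivity.Theorems

open Literature.MathematicalPhysics.QuantumLattice
open Literature.MathematicalPhysics.QuantumLattice.BandSectorCounting

/-! ### §0 The two `δ ↦ μ(δ)` links -/

/-- **`μ(δ)` lies in the doping window of record** `[-0.4275, -0.1775]` for `δ ∈ [0.10, 0.20]` (margin-2's certified
`μ(δ) ∈ [-0.42749, -0.1775]`). [folklore] -/
theorem klfs_muOfDoping_mem_dwin {δ : ℝ} (hδ : δ ∈ Icc (0.10 : ℝ) 0.20) :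
    chemicalPotentialOfDensity (squareDispersion 1 0) (1 - δ) ∈ Icc (-0.4275 : ℝ) (-0.1775) :=
  klfs_dwin_of_sub (Or.inl (muOfDoping_mem_window_d010_d020 δ hδ))

/-- **`μ(δ)` lies in the analysis window** `[-1, -0.15]` for `δ ∈ [0.10, 0.35]` (S0 `MuOfDopingWindow`), hence
`-2 < μ(δ) < 0`. [folklore] -/
theorem klfs_muOfDoping_mem_analysisWindow {δ : ℝ} (hδ : δ ∈ Icc (0.10 : ℝ) 0.35) :
    chemicalPotentialOfDensity (squareDispersion 1 0) (1 - δ) ∈ Icc (-1 : ℝ) (-0.15) ∧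
    -2 < chemicalPotentialOfDensity (squareDispersion 1 0) (1 - δ) ∧
    chemicalPotentialOfDensity (squareDispersion 1 0) (1 - δ) < 0 := by
  have h := muOfDopingWindow_proof δ hδ
  exact ⟨h, by linarith [h.1], by linarith [h.2]⟩

/-- The window of record is a sub-window of the leaf's: `[0.10, 0.20] ⊆ [0.10, 0.35]`. [folklore] -/
theorem klfs_dopingWindow_sub {δ : ℝ} (hδ : δ ∈ Icc (0.10 : ℝ) 0.20) : δ ∈ Icc (0.10 : ℝ) 0.35 :=
  ⟨hδ.1, hδ.2.trans (by norm_num)⟩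

/-! ### §1 The window of record `δ ∈ [0.10, 0.20]` -/

/-- **Speed, curvature, nesting at `μ(δ)`, `δ ∈ [0.10, 0.20]`**: on the Fermi curve `{ε₀ = μ(δ)}`, `∇ε₀ ≠ 0` and
`‖∇ε₀‖ ≥ 0.8237`; at every level point `-2(cos x + cos y) = μ(δ)` the curvature lies in `[0.0313, 2.43]`; the `(π,π)` nesting
defect is `≥ 0.355`. [folklore] -/
theorem klfs_doping_geometry {δ : ℝ} (hδ : δ ∈ Icc (0.10 : ℝ) 0.20) :
    (∀ k ∈ fermiCurve (squareDispersion 1 0) (chemicalPotentialOfDensity (squareDispersion 1 0) (1 - δ)),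
      gradient (squareDispersion 1 0) k ≠ 0 ∧ (0.8237 : ℝ) ≤ ‖gradient (squareDispersion 1 0) k‖) ∧
    (∀ x y : ℝ, -2 * (Real.cos x + Real.cos y) = chemicalPotentialOfDensity (squareDispersion 1 0) (1 - δ) →
      (Real.cos x * Real.sin y ^ 2 + Real.cos y * Real.sin x ^ 2) /
        ((Real.sin x ^ 2 + Real.sin y ^ 2) * Real.sqrt (Real.sin x ^ 2 + Real.sin y ^ 2)) ∈ Icc (0.0313 : ℝ) 2.43) ∧
    (∀ k : Fin 2 → ℝ, sqDispersion k = chemicalPotentialOfDensity (squareDispersion 1 0) (1 - δ) →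
      (0.355 : ℝ) ≤ |sqDispersion (fun i => k i + π) - chemicalPotentialOfDensity (squareDispersion 1 0) (1 - δ)|) := by
  have hμ := klfs_muOfDoping_mem_dwin hδ
  exact ⟨fun k hk => ⟨klfs_dwin_gradient_ne_zero hμ hk, klfs_dwin_norm_gradient_ge hμ hk⟩,
    fun x y h => klfs_dwin_curvature hμ h, fun k hk => klfs_dwin_nesting_defect hμ hk⟩

/-- **FST II's hypotheses at `μ(δ)`, `δ ∈ [0.10, 0.20]`: (A1)–(A4), (Sy), (A3) global HOLD, (A5) FAILS** — with the explicit
`(1,0)` umklapp quadruple on the Fermi curve, a pair `p + q ∉` Brillouin zone, and the `(1,0)`-corner `3 p(θ*) ∈ F + 2π(1,0)`,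
`0 < θ* < π/4` (DECOMP App. A/F: «the window HAS umklapp ⇒ A5 fails ⇒ C4b is load-bearing», now in `δ`). [folklore] -/
theorem klfs_doping_fst2_umklapp {δ : ℝ} (hδ : δ ∈ Icc (0.10 : ℝ) 0.20) (U : ℝ) (k : ℕ) :
    (FermiRG.HypA1 (FermiRG.Crystal.cubic 2) k 0 (fun _ : ℝ × Momentum => (U : ℂ)) ∧
      FermiRG.HypA2 (FermiRG.Crystal.cubic 2) k 0
        (fun q : Momentum => squareDispersion 1 0 q - chemicalPotentialOfDensity (squareDispersion 1 0) (1 - δ)) ∧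
      FermiRG.HypA3 (fun q : Momentum => squareDispersion 1 0 q - chemicalPotentialOfDensity (squareDispersion 1 0) (1 - δ)) ∧
      FermiRG.HypA3Global (FermiRG.Crystal.cubic 2)
        (fun q : Momentum => squareDispersion 1 0 q - chemicalPotentialOfDensity (squareDispersion 1 0) (1 - δ)) ∧
      FermiRG.HypA4 (FermiRG.Crystal.cubic 2)
        (fun q : Momentum => squareDispersion 1 0 q - chemicalPotentialOfDensity (squareDispersion 1 0) (1 - δ)) ∧
      FermiRG.HypSy (fun p : Momentum => squareDispersion 1 0 p - chemicalPotentialOfDensity (squareDispersion 1 0) (1 - δ))) ∧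
    ¬ FermiRG.HypA5 (FermiRG.Crystal.cubic 2)
        (fun q : Momentum => squareDispersion 1 0 q - chemicalPotentialOfDensity (squareDispersion 1 0) (1 - δ)) ∧
    (∃ kk : Fin 4 → Fin 2 → ℝ, (∀ j i, |kk j i| < π) ∧
      (∀ j, sqDispersion (kk j) = chemicalPotentialOfDensity (squareDispersion 1 0) (1 - δ)) ∧
      (![(1 : ℤ), 0] : Fin 2 → ℤ) ≠ 0 ∧ ∀ i, ∑ j, kk j i = 2 * π * ((![(1 : ℤ), 0] : Fin 2 → ℤ) i : ℝ)) ∧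
    (∃ p q : Momentum, p ∈ fermiCurve (squareDispersion 1 0) (chemicalPotentialOfDensity (squareDispersion 1 0) (1 - δ)) ∧
      q ∈ fermiCurve (squareDispersion 1 0) (chemicalPotentialOfDensity (squareDispersion 1 0) (1 - δ)) ∧
      p + q ∉ brillouinZone) ∧
    (∃ θ ∈ Ioo (0 : ℝ) (π / 4),
      rayDispersion (θ, 3 * bandFermiRadius (chemicalPotentialOfDensity (squareDispersion 1 0) (1 - δ)) θ) =
        chemicalPotentialOfDensity (squareDispersion 1 0) (1 - δ) ∧
      π < ‖(3 * bandFermiRadius (chemicalPotentialOfDensity (squareDispersion 1 0) (1 - δ)) θ) • dir θ‖) := by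
  have hμ := klfs_muOfDoping_mem_dwin hδ
  exact ⟨klfs_dwin_fst2_hypotheses hμ U k, klfs_dwin_umklapp hμ⟩

/-- **Corner transversality at `μ(δ)`, `δ ∈ [0.10, 0.20]`**: at the `(1,0)`-corner, `sin²x₁ - sin²y₁ ≥ 0.1018`. [folklore] -/
theorem klfs_doping_corner_transversality_factor_ge {δ : ℝ} (hδ : δ ∈ Icc (0.10 : ℝ) 0.20) {θ : ℝ}
    (hθ : θ ∈ Ioo (0 : ℝ) (π / 4))
    (hcorner : rayDispersion (θ, 3 * bandFermiRadius (chemicalPotentialOfDensity (squareDispersion 1 0) (1 - δ)) θ) =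
      chemicalPotentialOfDensity (squareDispersion 1 0) (1 - δ)) :
    (0.1018 : ℝ) ≤ Real.sin (bandX (chemicalPotentialOfDensity (squareDispersion 1 0) (1 - δ)) θ) ^ 2 -
      Real.sin (bandY (chemicalPotentialOfDensity (squareDispersion 1 0) (1 - δ)) θ) ^ 2 :=
  klfs_dwin_corner_transversality_factor_ge (klfs_muOfDoping_mem_dwin hδ) hθ hcorner

/-- **The typed hypothesis sets at `μ(δ)`, `δ ∈ [0.10, 0.20]`**: FST II `GeomConstants e 4.4275 0.0887 0.575 0.0443`; FST III:
ONE datum `Admits M ⟨0, 40, normV, 0.574, 0.0887, 0.0443⟩` for any record carrying the band at `μ(δ)` with `v̂ ≡ U`,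
`|U| ≤ normV`, the hypotheses (H1)–(H4) of Thm 1.2, and `¬(H5)` on the crystal's cell. [folklore] -/
theorem klfs_doping_fst_constants {δ : ℝ} (hδ : δ ∈ Icc (0.10 : ℝ) 0.20) :
    FermiRG.GeomConstants
        (fun q : Momentum => squareDispersion 1 0 q - chemicalPotentialOfDensity (squareDispersion 1 0) (1 - δ))
        4.4275 0.0887 0.575 0.0443 ∧
    ∀ (M : FermiRG.FST3.Model 2),
      (M.e = fun p : Momentum => squareDispersion 1 0 p - chemicalPotentialOfDensity (squareDispersion 1 0) (1 - δ)) →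
      ∀ {U : ℝ}, (M.vhat = fun _ => (U : ℂ)) → ∀ {normV : ℝ}, |U| ≤ normV →
        FermiRG.FST3.Admits M ⟨0, 40, normV, 0.574, 0.0887, 0.0443⟩ ∧
        (FermiRG.FST3.H1 2 0 M ∧ FermiRG.FST3.H2 2 0 M ∧ FermiRG.FST3.H3 M ∧ FermiRG.FST3.H4 M) ∧
        (M.fund = (FermiRG.Crystal.cubic 2).fundamentalDomain → ¬ FermiRG.FST3.H5 M) := by
  have hμ := klfs_muOfDoping_mem_dwin hδ
  exact ⟨klfs_dwin_geomConstants hμ, fun M he U hv normV hV => klfs_dwin_fst3 hμ M he hv hV⟩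

/-- **The classes at `μ(δ)`, `δ ∈ [0.10, 0.20]`**: FST IV's inversion class EXCLUDES the band for every fundamental cell and
all constants; BGM 2006's regime and `e₀`-admissibility fail and Lemma 2.1 clause (3) is false at `h = 0`; FKT 2004's
hypotheses fail; Salmhofer 1998 §2.3 `ModelData.Hyp` HOLDS. [folklore] -/
theorem klfs_doping_classes {δ : ℝ} (hδ : δ ∈ Icc (0.10 : ℝ) 0.20) :
    (∀ (L : FermiRG.FST4.LatticeData 2), L.latt = ((FermiRG.Crystal.cubic 2).dualLattice : Set Momentum) →
      (∀ z ∈ L.fund, ∀ w ∈ L.fund, z - w ∈ L.latt → z = w) → ∀ δ₀ g₀ G₀ w₀ : ℝ,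
      ¬ FermiRG.FST4.InDispersionClass L δ₀ g₀ G₀ w₀
        (fun p : Momentum => squareDispersion 1 0 p - chemicalPotentialOfDensity (squareDispersion 1 0) (1 - δ))) ∧
    (¬ (chemicalPotentialOfDensity (squareDispersion 1 0) (1 - δ) < -2 - Real.sqrt 2) ∧
      ∀ e₀ : ℝ, ¬ FermiRG.BGMAdmissibleE0 (chemicalPotentialOfDensity (squareDispersion 1 0) (1 - δ)) e₀) ∧
    (∀ {E : ℤ → ℝ × (Fin 2 → ℝ) → ℂ}, FermiRG.BGMInitial E → ∀ β : ℝ,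
      ∃ k : Fin (2 * 2) → Fin 2 → ℝ, (∀ j, k j ∈ FermiRG.zoneSq ∧
        FermiRG.bgmEffDisp β E 0 (k j) = chemicalPotentialOfDensity (squareDispersion 1 0) (1 - δ) + 0) ∧
        ¬ Real.sqrt ((∑ j, k j 0) ^ 2 + (∑ j, k j 1) ^ 2) < 2 * π) ∧
    (∀ (D : FermiRG.FKT2004.FermiCurveData),
      (D.e = fun k : Momentum => squareDispersion 1 0 k - chemicalPotentialOfDensity (squareDispersion 1 0) (1 - δ)) →
      ∀ r : ℕ, ¬ FermiRG.FKT2004.Hypotheses r D) ∧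
    (∀ (U : ℝ) {k₀ : ℕ}, 2 ≤ k₀ → ∀ {ε₀ : ℝ}, 0 < ε₀ → ε₀ ≤ 1 →
      (FermiRG.Salmhofer1998.ModelData.mk 1
        (fun p : Fin 2 → ℝ => sqDispersion p - chemicalPotentialOfDensity (squareDispersion 1 0) (1 - δ))
        (fun _ _ => U) (fun _ => U) k₀ ε₀ : FermiRG.Salmhofer1998.ModelData 2).Hyp) :=
  klfs_dwin_classes (klfs_muOfDoping_mem_dwin hδ)

/-- **BGM 2003 at `μ(δ)`, `δ ∈ [0.10, 0.20]`, shell width `e₀ = 0.08`**: §1.2 `DispersionHyp`, the lattice class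
`LatticeModelHyp` (finitely supported pair potentials), and Lemma 3.1 (4.3) sector counting for the Hubbard band. [folklore] -/
theorem klfs_doping_bgm2003 {δ : ℝ} (hδ : δ ∈ Icc (0.10 : ℝ) 0.20) :
    FermiRG.BGM2003.DispersionHyp sqDispersion (chemicalPotentialOfDensity (squareDispersion 1 0) (1 - δ)) 0.08
        (fun θ e => bandFermiRadius (chemicalPotentialOfDensity (squareDispersion 1 0) (1 - δ) + e) θ) ∧
    (∀ (v : Fin 2 → Fin 2 → Literature.Probability.LatticeModels.Site 2 → ℝ),
      (∀ σ σ' : Fin 2, (Function.support (v σ σ')).Finite) →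
      FermiRG.BGM2003.LatticeModelHyp (fun k => sqDispersion k + 4)
        (chemicalPotentialOfDensity (squareDispersion 1 0) (1 - δ) + 4) 0.08
        (fun θ e => bandFermiRadius (chemicalPotentialOfDensity (squareDispersion 1 0) (1 - δ) + e) θ) v) ∧
    (∃ c : ℝ, 0 < c ∧ ∀ (n n' : ℕ), n ≤ n' →
      (∀ (L : ℕ) (i₁ : Fin L) (ω₁ : ℕ) (ωt : Fin L → ℕ), 4 ≤ L → ω₁ < sectorCount n' →
          (∀ i, ωt i < sectorCount n) →
          (Nat.card (FermiRG.BGM2003.sectorStrings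
              (fun ϑ e' => bandFermiRadius (chemicalPotentialOfDensity (squareDispersion 1 0) (1 - δ) + e') ϑ)
              0.08 n n' L i₁ ω₁ ωt) : ℝ) ≤ c ^ L * (2 : ℝ) ^ ((n' - n) * (L - 3))) ∧
      (∀ (i₁ : Fin 2) (ω₁ : ℕ) (ωt : Fin 2 → ℕ), ω₁ < sectorCount n' → (∀ i, ωt i < sectorCount n) →
          (Nat.card (FermiRG.BGM2003.sectorStrings
              (fun ϑ e' => bandFermiRadius (chemicalPotentialOfDensity (squareDispersion 1 0) (1 - δ) + e') ϑ)
              0.08 n n' 2 i₁ ω₁ ωt) : ℝ) ≤ c)) :=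
  klfs_dwin_bgm2003 (klfs_muOfDoping_mem_dwin hδ)

/-- **Radial transversality at `μ(δ)`, `δ ∈ [0.10, 0.20]`**: `∂ₜF(θ, u(θ)) ≥ 0.8236` at every angle. [folklore] -/
theorem klfs_doping_rayDispersionDt_ge {δ : ℝ} (hδ : δ ∈ Icc (0.10 : ℝ) 0.20) (θ : ℝ) :
    (0.8236 : ℝ) ≤ rayDispersionDt θ (bandFermiRadius (chemicalPotentialOfDensity (squareDispersion 1 0) (1 - δ)) θ) :=
  klfs_dwin_rayDispersionDt_ge (klfs_muOfDoping_mem_dwin hδ) θ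

/-- **ONE two-loop constant for the doping window** (FST II Thm 1.1, `d = 2`): `∃ Q ≥ 1` with
`𝓦(ε') ≤ Q ε' |log ε'|` at `μ(δ)` for every `δ ∈ [0.10, 0.20]` and `0 < ε' ≤ 1/2`. [folklore] -/
theorem klfs_doping_volW_le :
    ∃ Q : ℝ, 1 ≤ Q ∧ ∀ δ ∈ Icc (0.10 : ℝ) 0.20, ∀ ε' : ℝ, 0 < ε' → ε' ≤ 1 / 2 →
      FermiRG.volW (FermiRG.Crystal.cubic 2)
        (fun q : Momentum => squareDispersion 1 0 q - chemicalPotentialOfDensity (squareDispersion 1 0) (1 - δ)) ε' ≤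
        ENNReal.ofReal (Q * ε' * |Real.log ε'|) := by
  obtain ⟨Q, hQ, h⟩ := klfs_dwin_volW_le
  exact ⟨Q, hQ, fun δ hδ ε' hε hε2 => h _ (klfs_muOfDoping_mem_dwin hδ) ε' hε hε2⟩

/-- **The SHARP `BandBounds` bundle covers every `μ(δ)`, `δ ∈ [0.10, 0.20]`**: ONE `BandBounds (-0.4275) (-0.1775)` with
`umin ≥ 2.06`, `smax ≤ 3.85`, `A2 ≤ 33.2`, `hmin ≥ 0.188`, `amin ≥ 0.0648`, `rhomin ≥ 0.4118`, `cmax ≤ 0.685`, `Dtmin ≥ 0.8236`,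
`C_g ≤ 98`, `Dcell ≤ 3.14`, whose level range contains `μ(δ)` for every `δ` of the window of record. [folklore] -/
theorem klfs_doping_sharpBandBounds :
    ∃ B : BandBounds (-0.4275) (-0.1775),
      (2.06 ≤ B.umin ∧ B.smax ≤ 3.85 ∧ B.A2 ≤ 33.2 ∧ 0.188 ≤ B.hmin ∧ 0.0648 ≤ B.amin ∧ 0.4118 ≤ B.rhomin ∧
        B.cmax ≤ 0.685 ∧ 0.8236 ≤ B.Dtmin ∧ B.Cg ≤ 98 ∧ B.Dcell ≤ 3.14) ∧
      ∀ δ ∈ Icc (0.10 : ℝ) 0.20, chemicalPotentialOfDensity (squareDispersion 1 0) (1 - δ) ∈ Icc (-0.4275 : ℝ) (-0.1775) := by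
  obtain ⟨B, hB⟩ := klfs_dwin_sharpBandBounds
  exact ⟨B, hB, fun δ hδ => klfs_muOfDoping_mem_dwin hδ⟩

/-! ### §2 The leaf's window `δ ∈ [0.10, 0.35]` (analysis window `μ(δ) ∈ [-1, -0.15]`, S0) -/

/-- **Geometry at `μ(δ)`, `δ ∈ [0.10, 0.35]`**: `∇ε₀ ≠ 0`, `‖∇ε₀‖ ≥ 0.7599` on the Fermi curve; curvature `≥ 0.026` at every
level point; nesting defect `≥ 0.3`; `∂ₜF ≥ 0.7599`. [folklore] -/
theorem klfs_leafDoping_geometry {δ : ℝ} (hδ : δ ∈ Icc (0.10 : ℝ) 0.35) :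
    (∀ k ∈ fermiCurve (squareDispersion 1 0) (chemicalPotentialOfDensity (squareDispersion 1 0) (1 - δ)),
      gradient (squareDispersion 1 0) k ≠ 0 ∧ (0.7599 : ℝ) ≤ ‖gradient (squareDispersion 1 0) k‖) ∧
    (∀ x y : ℝ, -2 * (Real.cos x + Real.cos y) = chemicalPotentialOfDensity (squareDispersion 1 0) (1 - δ) →
      (0.026 : ℝ) ≤ (Real.cos x * Real.sin y ^ 2 + Real.cos y * Real.sin x ^ 2) /
        ((Real.sin x ^ 2 + Real.sin y ^ 2) * Real.sqrt (Real.sin x ^ 2 + Real.sin y ^ 2))) ∧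
    (∀ k : Fin 2 → ℝ, sqDispersion k = chemicalPotentialOfDensity (squareDispersion 1 0) (1 - δ) →
      (0.3 : ℝ) ≤ |sqDispersion (fun i => k i + π) - chemicalPotentialOfDensity (squareDispersion 1 0) (1 - δ)|) ∧
    (∀ θ : ℝ, (0.7599 : ℝ) ≤
      rayDispersionDt θ (bandFermiRadius (chemicalPotentialOfDensity (squareDispersion 1 0) (1 - δ)) θ)) := by
  obtain ⟨hμ, hμ₁, hμ₂⟩ := klfs_muOfDoping_mem_analysisWindow hδ
  refine ⟨fun k hk => ⟨klfs_gradient_ne_zero (by linarith) hμ₂ hk, ?_⟩, fun x y h => klfs_analysisWindow_curvature_ge hμ h,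
    fun k hk => ?_, fun θ => (klfs_windows_rayDispersionDt_ge (μ := _) θ).2 hμ⟩
  · have he : -2 * (Real.cos (k 0) + Real.cos (k 1)) = chemicalPotentialOfDensity (squareDispersion 1 0) (1 - δ) := by
      have := hk.2; simp [squareDispersion] at this; linarith
    rw [norm_gradient_squareDispersion]
    exact klfs_analysisWindow_fermiSpeed_ge hμ he
  · rw [klfs_nesting_defect hk, abs_of_neg (by linarith [hμ.2])]
    linarith [hμ.2]

/-- **The qualitative hypothesis sets at `μ(δ)`, `δ ∈ [0.10, 0.35]`**: FST II (A2), (A3), (A3) global, (A4), (Sy) hold and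
(A5) fails (with the `(1,0)` umklapp quadruple and the `(1,0)`-corner, transversality factor `≥ 0.083`); FST III (H1)–(H4)
hold; Salmhofer 1998 `ModelData.Hyp` holds; BGM 2003 `DispersionHyp` with `e₀ = 0.07`. [folklore] -/
theorem klfs_leafDoping_hypotheses {δ : ℝ} (hδ : δ ∈ Icc (0.10 : ℝ) 0.35) (k : ℕ) :
    (FermiRG.HypA2 (FermiRG.Crystal.cubic 2) k 0
        (fun q : Momentum => squareDispersion 1 0 q - chemicalPotentialOfDensity (squareDispersion 1 0) (1 - δ)) ∧
      FermiRG.HypA3 (fun q : Momentum => squareDispersion 1 0 q - chemicalPotentialOfDensity (squareDispersion 1 0) (1 - δ)) ∧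
      FermiRG.HypA3Global (FermiRG.Crystal.cubic 2)
        (fun q : Momentum => squareDispersion 1 0 q - chemicalPotentialOfDensity (squareDispersion 1 0) (1 - δ)) ∧
      FermiRG.HypA4 (FermiRG.Crystal.cubic 2)
        (fun q : Momentum => squareDispersion 1 0 q - chemicalPotentialOfDensity (squareDispersion 1 0) (1 - δ)) ∧
      FermiRG.HypSy (fun p : Momentum => squareDispersion 1 0 p - chemicalPotentialOfDensity (squareDispersion 1 0) (1 - δ)) ∧
      ¬ FermiRG.HypA5 (FermiRG.Crystal.cubic 2)
        (fun q : Momentum => squareDispersion 1 0 q - chemicalPotentialOfDensity (squareDispersion 1 0) (1 - δ))) ∧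
    ((∃ kk : Fin 4 → Fin 2 → ℝ, (∀ j i, |kk j i| < π) ∧
        (∀ j, sqDispersion (kk j) = chemicalPotentialOfDensity (squareDispersion 1 0) (1 - δ)) ∧
        (![(1 : ℤ), 0] : Fin 2 → ℤ) ≠ 0 ∧ ∀ i, ∑ j, kk j i = 2 * π * ((![(1 : ℤ), 0] : Fin 2 → ℤ) i : ℝ)) ∧
      (∃ θ ∈ Ioo (0 : ℝ) (π / 4),
        rayDispersion (θ, 3 * bandFermiRadius (chemicalPotentialOfDensity (squareDispersion 1 0) (1 - δ)) θ) =
          chemicalPotentialOfDensity (squareDispersion 1 0) (1 - δ) ∧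
        π < ‖(3 * bandFermiRadius (chemicalPotentialOfDensity (squareDispersion 1 0) (1 - δ)) θ) • dir θ‖) ∧
      (∀ θ ∈ Ioo (0 : ℝ) (π / 4),
        rayDispersion (θ, 3 * bandFermiRadius (chemicalPotentialOfDensity (squareDispersion 1 0) (1 - δ)) θ) =
          chemicalPotentialOfDensity (squareDispersion 1 0) (1 - δ) →
        (0.083 : ℝ) ≤ Real.sin (bandX (chemicalPotentialOfDensity (squareDispersion 1 0) (1 - δ)) θ) ^ 2 -
          Real.sin (bandY (chemicalPotentialOfDensity (squareDispersion 1 0) (1 - δ)) θ) ^ 2)) ∧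
    (∀ (M : FermiRG.FST3.Model 2),
      (M.e = fun p : Momentum => squareDispersion 1 0 p - chemicalPotentialOfDensity (squareDispersion 1 0) (1 - δ)) →
      ∀ {U : ℝ}, (M.vhat = fun _ => (U : ℂ)) →
        FermiRG.FST3.H1 2 0 M ∧ FermiRG.FST3.H2 2 0 M ∧ FermiRG.FST3.H3 M ∧ FermiRG.FST3.H4 M) ∧
    (∀ (U : ℝ) {k₀ : ℕ}, 2 ≤ k₀ → ∀ {ε₀ : ℝ}, 0 < ε₀ → ε₀ ≤ 1 →
      (FermiRG.Salmhofer1998.ModelData.mk 1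
        (fun p : Fin 2 → ℝ => sqDispersion p - chemicalPotentialOfDensity (squareDispersion 1 0) (1 - δ))
        (fun _ _ => U) (fun _ => U) k₀ ε₀ : FermiRG.Salmhofer1998.ModelData 2).Hyp) ∧
    FermiRG.BGM2003.DispersionHyp sqDispersion (chemicalPotentialOfDensity (squareDispersion 1 0) (1 - δ)) 0.07
        (fun θ e => bandFermiRadius (chemicalPotentialOfDensity (squareDispersion 1 0) (1 - δ) + e) θ) := by
  obtain ⟨hμ, hμ₁, hμ₂⟩ := klfs_muOfDoping_mem_analysisWindow hδ
  refine ⟨⟨klfs_hypA2 (by linarith) hμ₂ k, klfs_hypA3 (by linarith) hμ₂, klfs_hypA3Global (by linarith) hμ₂,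
      klfs_hypA4 hμ₂, klfs_hypSy _, klfs_not_hypA5 hμ₁.le hμ₂⟩,
    ⟨klfs_exists_umklapp_quadruple hμ₁.le hμ₂, klfs_exists_corner (by linarith) hμ₂ hμ₁,
      fun θ hθ hc => (klfs_windows_corner_transversality_factor_ge (Or.inr hμ) hθ hc).2 hμ⟩,
    fun M he U hv => klfs_fst3_theorem12_hypotheses (by linarith) hμ₂ M he hv,
    fun U k₀ hk ε₀ hε₀ hε₁ => klfs_sal98_hyp (by linarith) hμ₂ U hk hε₀ hε₁,
    klfs_analysisWindow_bgm2003_dispersionHyp hμ⟩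

/-- **ONE two-loop constant for the leaf's window** (FST II Thm 1.1, `d = 2`): `∃ Q ≥ 1` with `𝓦(ε') ≤ Q ε' |log ε'|` at
`μ(δ)` for every `δ ∈ [0.10, 0.35]` and `0 < ε' ≤ 1/2`. [folklore] -/
theorem klfs_leafDoping_volW_le :
    ∃ Q : ℝ, 1 ≤ Q ∧ ∀ δ ∈ Icc (0.10 : ℝ) 0.35, ∀ ε' : ℝ, 0 < ε' → ε' ≤ 1 / 2 →
      FermiRG.volW (FermiRG.Crystal.cubic 2)
        (fun q : Momentum => squareDispersion 1 0 q - chemicalPotentialOfDensity (squareDispersion 1 0) (1 - δ)) ε' ≤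
        ENNReal.ofReal (Q * ε' * |Real.log ε'|) := by
  obtain ⟨Q, hQ, h⟩ := kltl_windows_volW_le.2
  exact ⟨Q, hQ, fun δ hδ ε' hε hε2 => h _ (klfs_muOfDoping_mem_analysisWindow hδ).1 ε' hε hε2⟩

/-- **The SHARP `BandBounds (-1) (-0.15)` bundle covers every `μ(δ)`, `δ ∈ [0.10, 0.35]`**: ONE bundle with
`umin ≥ 1.86`, `smax ≤ 3.91`, `A2 ≤ 36.2`, `hmin ≥ 0.138`, `amin ≥ 0.0494`, `rhomin ≥ 0.3799`, `cmax ≤ 0.735`, `Dtmin ≥ 0.7599`,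
`C_g ≤ 162`, `Dcell ≤ 3.28`, whose level range contains every `μ(δ)` of the leaf's window. [folklore] -/
theorem klfs_leafDoping_sharpBandBounds :
    ∃ B : BandBounds (-1) (-0.15),
      (1.86 ≤ B.umin ∧ B.smax ≤ 3.91 ∧ B.A2 ≤ 36.2 ∧ 0.138 ≤ B.hmin ∧ 0.0494 ≤ B.amin ∧ 0.3799 ≤ B.rhomin ∧
        B.cmax ≤ 0.735 ∧ 0.7599 ≤ B.Dtmin ∧ B.Cg ≤ 162 ∧ B.Dcell ≤ 3.28) ∧
      ∀ δ ∈ Icc (0.10 : ℝ) 0.35, chemicalPotentialOfDensity (squareDispersion 1 0) (1 - δ) ∈ Icc (-1 : ℝ) (-0.15) := by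
  obtain ⟨B, hB⟩ := klfs_analysisWindow_sharpBandBounds_exactDt
  exact ⟨B, hB, fun δ hδ => (klfs_muOfDoping_mem_analysisWindow hδ).1⟩

end Summit.HubbardSuperconductivity.HubbardSuperconductivity.Theorems

end
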